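import Literature.MathematicalPhysics.QuantumFieldTheory.Balaban1983to89.B6Partition118KLevelFineSizes

/-!
# `Balaban1983to89.B6Partition118KLevelFineSecond` — T. Bałaban, *Propagators and renormalization transformations for lattice gauge theories. II*,
# Commun. Math. Phys. **96** (1984) 223–250 [Balaban1984PropagatorsII], p. 229 (2.36) / p. 239 (2.92) line 1 / p. 247: THE SECOND DIFFERENCES OF THE SMOOTH
# FINE-LATTICE PARTITION `{h_□}` OF `…B6Partition118KLevelFine` — **`|h_□(x + e_μ) − 2h_□(x) + h_□(x − e_μ)| ≤ C₂/(8S_□/5)²`** at every fine site along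
# every axis (`S_□ = ML^j` fine sites; `C₂` depends on `d, L` only) = the line-1 size `|Δ^ηh_□| ≤ O(1)M^{−1}(L^jη)^{−2}` consumed by (2.134) (file 3 of the family)

statement-level skeleton of published theorems with citation tags; proofs where landed; nothing here is a claim about the Yang–Mills mass gap

PDF held: `paper:balaban1984-cmp96-propagators-rt-ii` (journal page = PDF page + 222): p. 229 [PDF 7], p. 239 [PDF 17], p. 247 [PDF 25]; read from the tree
transcriptions (`…B6Cover236MultiLevelBlocks`, `…B6Eq291Generator`, `…B6Ineq2134Diag`).  PRINT p. 239 (2.92), line 1: *"(K_{□,□}A)_μ(x) = ([h_□Δ − Δh_□]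
G_□h_□A)_μ(x) + …"*; p. 247: *"… we get the estimate … with O(1)M^{−1} instead of θ"*; [Balaban1983RegularityDecay] §2 p. 577 *"|∂^ηh_j| ≤ O(M⁻¹),
|Δ^ηh_j| ≤ O(M⁻²)"* (the single-scale sizes, r01's `…B4PartitionUnity22` §5–§7).

CITATION HEADER (lean-in-tree rule) — WHAT IS REPRODUCED.  Phase-2 file of the `lit-balaban` typed skeleton (HOME `run/shared/lean/pub/lit-balaban/`), seat
**p38 gen 25**; offer (1) of B6-CLOSURE §5 item 7 (owner r03 g18, 2026-08-22T22:35:35Z), FILE 3; SKELETON rows **B6.Eq2.36** × **B5.Eq1.118** ×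
**B6.Eq2.134** (cells only; decls of record untouched; referee ref-4).  File 1 (`…B6Partition118KLevelFine`) built `thetaF`/`hF`; file 2
(`…B6Partition118KLevelFineSizes`) proved the overlap `≤ 3^{d+2}` on the collars, the comparability of scales and the first differences.  THIS FILE:
* §1 (real variables) the SECOND difference of `N^{−1/2}` at three values `≥ 1`: `|N_c^{−1/2} − 2N_b^{−1/2} + N_a^{−1/2}| ≤ ½|Δ N| + ½|δN⁻|(|δN⁺| + |δN⁻|)`
  (`inv_sqrt_second_diff_le`, exact algebra in the square roots — no Taylor remainder), the quotient rule `Δ(fg) = f_bΔg + g_bΔf + δf⁺δg⁺ + δf⁻δg⁻`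
  (`quot_second_diff_le`) and its form with uniform sizes (`quot_second_diff_bound`), squares (`abs_sq_second_diff_le`);
* §2 **`abs_hF_second_diff_le`**: for fine sites `x`, `x ± e_μ` of the box, `|hF □ (x + e_μ) − 2·hF □ x + hF □ (x − e_μ)| ≤ C2F d ℓ/(8S_□/5)²`,
  `C2F = (D₂ + 3^{d+2}(D₂ + D₁²) + 4·3^{2d+4}D₁² + 2·3^{d+2}D₁²)·L⁴` (`D₁ = sup|h′|`, `D₂ = sup|h″|` of r01's profile): every one of the `≤ 3^{d+2}` bumps
  active on the collar moves by `≤ D₁L²/(8S/5)` and bends by `≤ D₂L⁴/(8S/5)²` (file 1's axis sizes at the comparable scales of file 2), so the normalising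
  sum moves by `≤ 2·3^{d+2}α` and bends by `≤ 3^{d+2}(2β + 2α²)`, and the quotient rule closes.
No new fact; one closed-form constant (`C2F`, a def); standard axioms.
HONEST SCOPE. As files 1–2: constants `L`-, `d`-dependent and `k`-, `M_h`-independent; the level form `s₂/(M·(L^jη)²)` of the binder `hc₀` of
`…B6Ineq2134KFamKLevel.h2134_kFam_kLevel` follows from `lev x ≤ j + 1` on the support (file 1) and is packaged with the `d`-metric binders later.
Integer box; nothing on d = 4 or the continuum; NOT summit progress.  Unit `lit-balaban-p38` (gen 25), 2026-08-22.
-/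

namespace Literature.MathematicalPhysics.QuantumFieldTheory.Balaban1983to89.B6Partition118KLevelFineSecond

open Finset
open Literature.MathematicalPhysics.QuantumFieldTheory.Balaban1983to89.B4ContourShift (supNorm)
open Literature.MathematicalPhysics.QuantumFieldTheory.Balaban1983to89.B4Reflection242 (boxDom mem_boxDom blk)
open Literature.MathematicalPhysics.QuantumFieldTheory.Balaban1983to89.B6MultiLevelBoxOperator
open Literature.MathematicalPhysics.QuantumFieldTheory.Balaban1983to89.B6Geom246MultiLevelBox
open Literature.MathematicalPhysics.QuantumFieldTheory.Balaban1983to89.B6Cover236MultiLevelBlocks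
  (cubes side side_eq side_pos ctr side_le_Lsq_mul_side)
open Literature.MathematicalPhysics.QuantumFieldTheory.Balaban1983to89.B4PartitionUnity22
  (hprof contDiff_hprof hasCompactSupport_hprof D1 D2 D1_nonneg D2_nonneg)
open Literature.MathematicalPhysics.QuantumFieldTheory.Balaban1983to89.B6Partition118KLevelFine
  (sF sF_pos thetaF thetaF_nonneg thetaF_le_one dist_lt_of_thetaF_ne_zero abs_thetaF_sub_le abs_thetaF_axis_diff_le abs_thetaF_axis_second_diff_le
    nsqF one_le_nsqF hF lev_window_of_dist_lt_three_halves)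
open Literature.MathematicalPhysics.QuantumFieldTheory.Balaban1983to89.B6Partition118KLevelFineSizes
  (inv_sqrt_sub_le abs_sq_sub_sq_le two_le_side card_collar_le sF_le_Lsq_mul_sF dist_collar_of_near)

variable {d : ℕ} {ℓ Mh k R : ℕ} {P : Fin (d + 1) → ℕ} (D : Domains d ℓ Mh k P R)

/-! ## §1  The calculus of `θ/N^{1/2}`, second differences (real variables) -/

section Real

/-- the second difference of `1/√·` at three values `≥ 1`:
`|N_c^{−1/2} − 2N_b^{−1/2} + N_a^{−1/2}| ≤ ½|N_c − 2N_b + N_a| + ½|N_a − N_b|(|N_c − N_b| + |N_a − N_b|)`. [folklore] -/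
private theorem inv_sqrt_second_diff_le {Na Nb Nc : ℝ} (ha : 1 ≤ Na) (hb : 1 ≤ Nb) (hc : 1 ≤ Nc) :
    |(Real.sqrt Nc)⁻¹ - 2 * (Real.sqrt Nb)⁻¹ + (Real.sqrt Na)⁻¹| ≤
      |Nc - 2 * Nb + Na| / 2 + |Na - Nb| * (|Nc - Nb| + |Na - Nb|) / 2 := by
  set x := Real.sqrt Na with hx
  set s := Real.sqrt Nb with hs
  set y := Real.sqrt Nc with hy
  have hx1 : 1 ≤ x := by rw [hx, ← Real.sqrt_one]; exact Real.sqrt_le_sqrt ha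
  have hs1 : 1 ≤ s := by rw [hs, ← Real.sqrt_one]; exact Real.sqrt_le_sqrt hb
  have hy1 : 1 ≤ y := by rw [hy, ← Real.sqrt_one]; exact Real.sqrt_le_sqrt hc
  have hxa : x ^ 2 = Na := by rw [hx, Real.sq_sqrt (by linarith)]
  have hsb : s ^ 2 = Nb := by rw [hs, Real.sq_sqrt (by linarith)]
  have hyc : y ^ 2 = Nc := by rw [hy, Real.sq_sqrt (by linarith)]
  have hx0 : 0 < x := by linarith
  have hs0 : 0 < s := by linarith
  have hy0 : 0 < y := by linarith
  set Wy : ℝ := (s * y * (s + y))⁻¹ with hWy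
  set Wx : ℝ := (s * x * (s + x))⁻¹ with hWx
  have hWy0 : 0 < Wy := by rw [hWy]; positivity
  have hWyle : Wy ≤ 1 / 2 := by
    rw [hWy, inv_eq_one_div]
    exact div_le_div_of_nonneg_left zero_le_one (by norm_num) (by nlinarith [mul_nonneg (sub_nonneg.2 hs1) (sub_nonneg.2 hy1)])
  have e1 : y⁻¹ - s⁻¹ = -(Nc - Nb) * Wy := by rw [← hyc, ← hsb, hWy]; field_simp; ring
  have e2 : x⁻¹ - s⁻¹ = -(Na - Nb) * Wx := by rw [← hxa, ← hsb, hWx]; field_simp; ring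
  have eW : Wy - Wx = (x - y) * (s + x + y) / (s * x * y * (s + x) * (s + y)) := by
    rw [hWy, hWx]; field_simp; ring
  have hW : |Wy - Wx| ≤ (|Nc - Nb| + |Na - Nb|) / 2 := by
    have hxy : |x - y| * (x + y) = |Na - Nc| := by
      rw [← hxa, ← hyc, ← abs_of_pos (by linarith : 0 < x + y), ← abs_mul]; congr 1; ring
    have hNN : |Na - Nc| ≤ |Nc - Nb| + |Na - Nb| := by
      calc |Na - Nc| = |(Na - Nb) - (Nc - Nb)| := by ring_nf
        _ ≤ |Na - Nb| + |Nc - Nb| := abs_sub _ _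
        _ = |Nc - Nb| + |Na - Nb| := add_comm _ _
    rw [eW, abs_div, abs_mul, abs_of_pos (by positivity : 0 < s + x + y),
      abs_of_pos (by positivity : 0 < s * x * y * (s + x) * (s + y)), div_le_iff₀ (by positivity)]
    have h1 : (s + x + y) ≤ (s + x) * (s + y) := by nlinarith
    have h2 : (1 : ℝ) ≤ s * x * y := by
      have := mul_le_mul hs1 hx1 zero_le_one (by linarith); nlinarith
    have hxyabs : |x - y| * 2 ≤ |Na - Nc| := by
      rw [← hxy]; exact mul_le_mul_of_nonneg_left (by linarith) (abs_nonneg _)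
    have hA := abs_nonneg (x - y)
    calc |x - y| * (s + x + y) ≤ |x - y| * ((s + x) * (s + y)) := mul_le_mul_of_nonneg_left h1 hA
      _ ≤ (|Na - Nc| / 2) * ((s + x) * (s + y)) := mul_le_mul_of_nonneg_right (by linarith) (by positivity)
      _ ≤ ((|Nc - Nb| + |Na - Nb|) / 2) * ((s + x) * (s + y)) := mul_le_mul_of_nonneg_right (by linarith) (by positivity)
      _ ≤ ((|Nc - Nb| + |Na - Nb|) / 2) * ((s + x) * (s + y)) * (s * x * y) := le_mul_of_one_le_right (by positivity) h2
      _ = (|Nc - Nb| + |Na - Nb|) / 2 * (s * x * y * (s + x) * (s + y)) := by ring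
  have eΔ : y⁻¹ - 2 * s⁻¹ + x⁻¹ = -(Nc - 2 * Nb + Na) * Wy + (Na - Nb) * (Wy - Wx) := by
    have : y⁻¹ - 2 * s⁻¹ + x⁻¹ = (y⁻¹ - s⁻¹) + (x⁻¹ - s⁻¹) := by ring
    rw [this, e1, e2]; ring
  rw [eΔ]
  calc |-(Nc - 2 * Nb + Na) * Wy + (Na - Nb) * (Wy - Wx)|
      ≤ |-(Nc - 2 * Nb + Na) * Wy| + |(Na - Nb) * (Wy - Wx)| := abs_add_le _ _
    _ = |Nc - 2 * Nb + Na| * Wy + |Na - Nb| * |Wy - Wx| := by rw [abs_mul, abs_mul, abs_neg, abs_of_pos hWy0]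
    _ ≤ |Nc - 2 * Nb + Na| * (1 / 2) + |Na - Nb| * ((|Nc - Nb| + |Na - Nb|) / 2) :=
        add_le_add (mul_le_mul_of_nonneg_left hWyle (abs_nonneg _)) (mul_le_mul_of_nonneg_left hW (abs_nonneg _))
    _ = |Nc - 2 * Nb + Na| / 2 + |Na - Nb| * (|Nc - Nb| + |Na - Nb|) / 2 := by ring

/-- the quotient rule, second differences (`h = f·g`, `g = N^{−1/2}`: `Δh = f_bΔg + g_bΔf + δf⁺δg⁺ + δf⁻δg⁻`): `f_b ∈ [0,1]`, `N ≥ 1` ⟹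
`|f_c/√N_c − 2f_b/√N_b + f_a/√N_a| ≤ |Δf| + ½|ΔN| + ½|δN⁻|(|δN⁺| + |δN⁻|) + ½|δf⁺||δN⁺| + ½|δf⁻||δN⁻|`. [folklore] -/
private theorem quot_second_diff_le {fa fb fc Na Nb Nc : ℝ} (hf0 : 0 ≤ fb) (hf1 : fb ≤ 1) (ha : 1 ≤ Na) (hb : 1 ≤ Nb)
    (hc : 1 ≤ Nc) :
    |fc / Real.sqrt Nc - 2 * (fb / Real.sqrt Nb) + fa / Real.sqrt Na| ≤
      |fc - 2 * fb + fa| + (|Nc - 2 * Nb + Na| / 2 + |Na - Nb| * (|Nc - Nb| + |Na - Nb|) / 2) +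
        |fc - fb| * (|Nc - Nb| / 2) + |fa - fb| * (|Na - Nb| / 2) := by
  set ga := (Real.sqrt Na)⁻¹ with hga
  set gb := (Real.sqrt Nb)⁻¹ with hgb
  set gc := (Real.sqrt Nc)⁻¹ with hgc
  have hsb : 1 ≤ Real.sqrt Nb := by rw [← Real.sqrt_one]; exact Real.sqrt_le_sqrt hb
  have hgb0 : 0 ≤ gb := by rw [hgb]; positivity
  have hgb1 : gb ≤ 1 := by rw [hgb]; exact inv_le_one_of_one_le₀ hsb
  have e : fc / Real.sqrt Nc - 2 * (fb / Real.sqrt Nb) + fa / Real.sqrt Na =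
      fb * (gc - 2 * gb + ga) + gb * (fc - 2 * fb + fa) + (fc - fb) * (gc - gb) + (fa - fb) * (ga - gb) := by
    simp only [div_eq_mul_inv, hga, hgb, hgc]; ring
  rw [e]
  have h1 : |fb * (gc - 2 * gb + ga)| ≤ |Nc - 2 * Nb + Na| / 2 + |Na - Nb| * (|Nc - Nb| + |Na - Nb|) / 2 := by
    rw [abs_mul, abs_of_nonneg hf0]
    calc fb * |gc - 2 * gb + ga| ≤ 1 * |gc - 2 * gb + ga| := mul_le_mul_of_nonneg_right hf1 (abs_nonneg _)
      _ ≤ _ := by rw [one_mul]; exact inv_sqrt_second_diff_le ha hb hc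
  have h2 : |gb * (fc - 2 * fb + fa)| ≤ |fc - 2 * fb + fa| := by
    rw [abs_mul, abs_of_nonneg hgb0]
    calc gb * |fc - 2 * fb + fa| ≤ 1 * |fc - 2 * fb + fa| := mul_le_mul_of_nonneg_right hgb1 (abs_nonneg _)
      _ = _ := one_mul _
  have h3 : |(fc - fb) * (gc - gb)| ≤ |fc - fb| * (|Nc - Nb| / 2) := by
    rw [abs_mul]; exact mul_le_mul_of_nonneg_left (inv_sqrt_sub_le hb hc) (abs_nonneg _)
  have h4 : |(fa - fb) * (ga - gb)| ≤ |fa - fb| * (|Na - Nb| / 2) := by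
    rw [abs_mul]; exact mul_le_mul_of_nonneg_left (inv_sqrt_sub_le hb ha) (abs_nonneg _)
  calc |fb * (gc - 2 * gb + ga) + gb * (fc - 2 * fb + fa) + (fc - fb) * (gc - gb) + (fa - fb) * (ga - gb)|
      ≤ |fb * (gc - 2 * gb + ga)| + |gb * (fc - 2 * fb + fa)| + |(fc - fb) * (gc - gb)| + |(fa - fb) * (ga - gb)| := by
        refine (abs_add_le _ _).trans (add_le_add ((abs_add_le _ _).trans (add_le_add (abs_add_le _ _) le_rfl)) le_rfl)
    _ ≤ _ := by linarith

/-- the quotient rule for second differences with uniform sizes plugged in: moves `≤ α`, second differences `≤ β` of the numerator, `|δN| ≤ 2mα`,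
`|ΔN| ≤ m(2β + 2α²)` ⟹ `|Δ(f/√N)| ≤ β + m(β + α²) + 4m²α² + 2mα²`. [folklore] -/
private theorem quot_second_diff_bound {fa fb fc Na Nb Nc α β m : ℝ} (hf0 : 0 ≤ fb) (hf1 : fb ≤ 1) (ha : 1 ≤ Na) (hb : 1 ≤ Nb)
    (hc : 1 ≤ Nc) (hα : 0 ≤ α) (hm : 0 ≤ m) (h1 : |fc - fb| ≤ α) (h2 : |fa - fb| ≤ α) (h3 : |fc - 2 * fb + fa| ≤ β)
    (h4 : |Nc - Nb| ≤ 2 * m * α) (h5 : |Na - Nb| ≤ 2 * m * α) (h6 : |Nc - 2 * Nb + Na| ≤ m * (2 * β + 2 * α ^ 2)) :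
    |fc / Real.sqrt Nc - 2 * (fb / Real.sqrt Nb) + fa / Real.sqrt Na| ≤ β + m * (β + α ^ 2) + 4 * m ^ 2 * α ^ 2 + 2 * m * α ^ 2 := by
  refine (quot_second_diff_le hf0 hf1 ha hb hc).trans ?_
  have hAp := abs_nonneg (Nc - Nb)
  have hAm := abs_nonneg (Na - Nb)
  have hcross : |Na - Nb| * (|Nc - Nb| + |Na - Nb|) / 2 ≤ 4 * m ^ 2 * α ^ 2 := by
    have h := mul_le_mul h5 (add_le_add h4 h5) (by positivity) (by positivity)
    have e : 2 * m * α * (2 * m * α + 2 * m * α) = 2 * (4 * m ^ 2 * α ^ 2) := by ring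
    rw [e] at h
    linarith
  have hc1 : |fc - fb| * (|Nc - Nb| / 2) ≤ m * α ^ 2 := by
    have h := mul_le_mul h1 h4 hAp hα
    have e : α * (2 * m * α) = 2 * (m * α ^ 2) := by ring
    rw [e] at h
    linarith
  have hc2 : |fa - fb| * (|Na - Nb| / 2) ≤ m * α ^ 2 := by
    have h := mul_le_mul h2 h5 hAm hα
    have e : α * (2 * m * α) = 2 * (m * α ^ 2) := by ring
    rw [e] at h
    linarith
  have h6' : |Nc - 2 * Nb + Na| / 2 ≤ m * (β + α ^ 2) := by linarith
  linarith

/-- second differences of squares: `|θ_c² − 2θ_b² + θ_a²| ≤ 2|Δθ| + (δθ⁺)² + (δθ⁻)²` (`θ_b ∈ [0, 1]`). [folklore] -/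
private theorem abs_sq_second_diff_le {θa θb θc : ℝ} (h0 : 0 ≤ θb) (h1 : θb ≤ 1) :
    |θc ^ 2 - 2 * θb ^ 2 + θa ^ 2| ≤ 2 * |θc - 2 * θb + θa| + (θc - θb) ^ 2 + (θa - θb) ^ 2 := by
  have e : θc ^ 2 - 2 * θb ^ 2 + θa ^ 2 = 2 * θb * (θc - 2 * θb + θa) + ((θc - θb) ^ 2 + (θa - θb) ^ 2) := by ring
  rw [e]
  calc |2 * θb * (θc - 2 * θb + θa) + ((θc - θb) ^ 2 + (θa - θb) ^ 2)|
      ≤ |2 * θb * (θc - 2 * θb + θa)| + |(θc - θb) ^ 2 + (θa - θb) ^ 2| := abs_add_le _ _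
    _ = 2 * θb * |θc - 2 * θb + θa| + ((θc - θb) ^ 2 + (θa - θb) ^ 2) := by
        rw [abs_mul, abs_of_nonneg (by linarith : 0 ≤ 2 * θb), abs_of_nonneg (by positivity : 0 ≤ (θc - θb) ^ 2 + (θa - θb) ^ 2)]
    _ ≤ 2 * 1 * |θc - 2 * θb + θa| + ((θc - θb) ^ 2 + (θa - θb) ^ 2) := by
        have := abs_nonneg (θc - 2 * θb + θa); nlinarith
    _ = _ := by ring

end Real

/-! ## §2  Second differences of `h_□` along an axis -/

/-- the constant `C₂ = (D₂ + 3^{d+2}(D₂ + D₁²) + 4·3^{2d+4}D₁² + 2·3^{d+2}D₁²)·L⁴` of the second differences. OURS.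
[cite: Balaban1984PropagatorsII, p.247 («O(1)M^{−1}»), bookkeeping] -/
noncomputable def C2F (d ℓ : ℕ) : ℝ :=
  D2 hprof * ((ℓ : ℝ) + 1) ^ 4 + 3 ^ (d + 2) * (D2 hprof * ((ℓ : ℝ) + 1) ^ 4 + D1 hprof ^ 2 * ((ℓ : ℝ) + 1) ^ 4)
    + 4 * (3 ^ (d + 2)) ^ 2 * (D1 hprof ^ 2 * ((ℓ : ℝ) + 1) ^ 4) + 2 * 3 ^ (d + 2) * (D1 hprof ^ 2 * ((ℓ : ℝ) + 1) ^ 4)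

/-- `C₂ ≥ 0`. [cite: Balaban1984PropagatorsII, p.247, bookkeeping] -/
theorem C2F_nonneg (d ℓ : ℕ) : 0 ≤ C2F d ℓ := by
  have := D1_nonneg contDiff_hprof hasCompactSupport_hprof
  have := D2_nonneg contDiff_hprof hasCompactSupport_hprof
  unfold C2F; positivity

/-- an axis move of an integer point, seen in `ℝ^{d+1}`. [folklore] -/
private theorem toR_update (z : Fin (d + 1) → ℤ) (μ : Fin (d + 1)) (t : ℤ) :
    toR (Function.update z μ (z μ + t)) = Function.update (toR z) μ (toR z μ + t) := by
  funext ν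
  by_cases h : ν = μ
  · subst h; simp [toR]
  · simp [toR, Function.update_of_ne h]

/-- an axis move has sup-length `1`. [folklore] -/
private theorem dist_toR_update_le (z : Fin (d + 1) → ℤ) (μ : Fin (d + 1)) {t : ℤ} (ht : |t| ≤ 1) :
    dist (toR z) (toR (Function.update z μ (z μ + t))) ≤ 1 := by
  rw [toR_update]
  refine (dist_pi_le_iff zero_le_one).2 fun ν => ?_
  by_cases h : ν = μ
  · subst h
    rw [Function.update_self, Real.dist_eq, show toR z ν - (toR z ν + (t : ℝ)) = -(t : ℝ) by ring, abs_neg]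
    exact_mod_cast ht
  · rw [Function.update_of_ne h, dist_self]; exact zero_le_one

/-- **`|h_□(x + e_μ) − 2h_□(x) + h_□(x − e_μ)| ≤ C₂/(8S/5)²`** at every fine site whose two axis neighbours are box sites («|Δ^ηh_□| ≤ O(1)(ML^jη)^{−2}»
with the normalisation across the `≤ 3^{d+2}` active cubes of comparable scales: the quotient rule for second differences).
[cite: Balaban1984PropagatorsII, p.247 after (2.134), (2.92) p.239 line 1] -/
theorem abs_hF_second_diff_le (hℓ : 1 ≤ ℓ) (hMh : 1 ≤ Mh) (hR : 2 * (ℓ + 1) ≤ R) (i : ↥(cubes D)) (μ : Fin (d + 1))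
    {x xp xm : ↥(boxDom (N0 ℓ Mh k P))} (hp : xp.1 = Function.update x.1 μ (x.1 μ + 1))
    (hm : xm.1 = Function.update x.1 μ (x.1 μ + (-1))) :
    |hF D i xp - 2 * hF D i x + hF D i xm| ≤ C2F d ℓ / sF D i ^ 2 := by
  have hs := sF_pos D hMh i
  have hS2 := two_le_side D hℓ hMh i
  have hD1 := D1_nonneg contDiff_hprof hasCompactSupport_hprof
  have hD2 := D2_nonneg contDiff_hprof hasCompactSupport_hprof
  have hL1 : (1 : ℝ) ≤ ((ℓ : ℝ) + 1) ^ 2 := by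
    have h0 : (0 : ℝ) ≤ ℓ := by positivity
    nlinarith
  have hdp : dist (toR x.1) (toR xp.1) ≤ 1 := by rw [hp]; exact dist_toR_update_le x.1 μ (by norm_num)
  have hdm : dist (toR x.1) (toR xm.1) ≤ 1 := by rw [hm]; exact dist_toR_update_le x.1 μ (by norm_num)
  have eRp : toR xp.1 = Function.update (toR x.1) μ (toR x.1 μ + 1) := by rw [hp, toR_update]; push_cast; rfl
  have eRm : toR xm.1 = Function.update (toR x.1) μ (toR x.1 μ - 1) := by rw [hm, toR_update]; push_cast; ring_nf
  -- trivial when `θ_□` vanishes at the three sites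
  by_cases h0 : thetaF D i (toR x.1) = 0 ∧ thetaF D i (toR xp.1) = 0 ∧ thetaF D i (toR xm.1) = 0
  · have e1 : hF D i x = 0 := by unfold hF; rw [h0.1, zero_div]
    have e2 : hF D i xp = 0 := by unfold hF; rw [h0.2.1, zero_div]
    have e3 : hF D i xm = 0 := by unfold hF; rw [h0.2.2, zero_div]
    rw [e1, e2, e3]; norm_num; exact div_nonneg (C2F_nonneg d ℓ) (sq_nonneg _)
  have hxi : dist (toR x.1) (ctr D i) < side D i + 1 := by
    rcases not_and_or.1 h0 with h | h
    · have := dist_lt_of_thetaF_ne_zero D hMh h; linarith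
    rcases not_and_or.1 h with h | h
    · exact dist_collar_of_near D (ρ := 1) (dist_lt_of_thetaF_ne_zero D hMh h) (by rw [dist_comm]; exact hdp)
    · exact dist_collar_of_near D (ρ := 1) (dist_lt_of_thetaF_ne_zero D hMh h) (by rw [dist_comm]; exact hdm)
  have hxi' : dist (toR x.1) (ctr D i) < 3 / 2 * side D i := by linarith
  classical
  set A := Finset.univ.filter fun c : ↥(cubes D) => dist (toR x.1) (ctr D c) < 3 / 2 * side D c with hA
  have hAcard : (#A : ℝ) ≤ 3 ^ (d + 2) := by exact_mod_cast card_collar_le D hMh hR x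
  have hmemA : ∀ c : ↥(cubes D), (thetaF D c (toR x.1) ≠ 0 ∨ thetaF D c (toR xp.1) ≠ 0 ∨ thetaF D c (toR xm.1) ≠ 0) → c ∈ A := by
    intro c hc
    rw [hA, Finset.mem_filter]
    refine ⟨Finset.mem_univ _, ?_⟩
    have hSc := side_pos D hMh c
    have hS2c := two_le_side D hℓ hMh c
    rcases hc with h | h | h
    · have := dist_lt_of_thetaF_ne_zero D hMh h; linarith
    · have := dist_collar_of_near D (ρ := 1) (dist_lt_of_thetaF_ne_zero D hMh h) (by rw [dist_comm]; exact hdp); linarith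
    · have := dist_collar_of_near D (ρ := 1) (dist_lt_of_thetaF_ne_zero D hMh h) (by rw [dist_comm]; exact hdm); linarith
  -- sizes `α = D₁L²/(8S/5)`, `β = D₂L⁴/(8S/5)²` of the moves of every active bump
  set α : ℝ := D1 hprof * ((ℓ : ℝ) + 1) ^ 2 / sF D i with hα
  set β : ℝ := D2 hprof * ((ℓ : ℝ) + 1) ^ 4 / sF D i ^ 2 with hβ
  have hα0 : 0 ≤ α := by positivity
  have hβ0 : 0 ≤ β := by positivity
  have hmove : ∀ c ∈ A, |thetaF D c (toR xp.1) - thetaF D c (toR x.1)| ≤ α ∧ |thetaF D c (toR xm.1) - thetaF D c (toR x.1)| ≤ α ∧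
      |thetaF D c (toR xp.1) - 2 * thetaF D c (toR x.1) + thetaF D c (toR xm.1)| ≤ β := by
    intro c hc
    have hcd := (Finset.mem_filter.1 hc).2
    have hsc := sF_pos D hMh c
    have hcmp := sF_le_Lsq_mul_sF D hMh hR hxi' hcd
    have hinv : 1 / sF D c ≤ ((ℓ : ℝ) + 1) ^ 2 / sF D i := by
      rw [div_le_div_iff₀ hsc hs]; nlinarith
    have hinv2 : 1 / sF D c ^ 2 ≤ ((ℓ : ℝ) + 1) ^ 4 / sF D i ^ 2 := by
      have := mul_le_mul hinv hinv (by positivity) (by positivity)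
      calc 1 / sF D c ^ 2 = 1 / sF D c * (1 / sF D c) := by ring
        _ ≤ ((ℓ : ℝ) + 1) ^ 2 / sF D i * (((ℓ : ℝ) + 1) ^ 2 / sF D i) := this
        _ = _ := by ring
    refine ⟨?_, ?_, ?_⟩
    · have h := abs_thetaF_axis_diff_le D hMh c (toR x.1) μ 1
      rw [← eRp, abs_one, mul_one] at h
      calc _ ≤ D1 hprof / sF D c := h
        _ = D1 hprof * (1 / sF D c) := by ring
        _ ≤ D1 hprof * (((ℓ : ℝ) + 1) ^ 2 / sF D i) := mul_le_mul_of_nonneg_left hinv hD1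
        _ = α := by rw [hα]; ring
    · have h := abs_thetaF_axis_diff_le D hMh c (toR x.1) μ (-1)
      rw [← sub_eq_add_neg, ← eRm, abs_neg, abs_one, mul_one] at h
      calc _ ≤ D1 hprof / sF D c := h
        _ = D1 hprof * (1 / sF D c) := by ring
        _ ≤ D1 hprof * (((ℓ : ℝ) + 1) ^ 2 / sF D i) := mul_le_mul_of_nonneg_left hinv hD1
        _ = α := by rw [hα]; ring
    · have h := abs_thetaF_axis_second_diff_le D c (toR x.1) μ 1
      rw [← eRp, ← eRm, one_pow, mul_one] at h
      calc _ ≤ D2 hprof / sF D c ^ 2 := h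
        _ = D2 hprof * (1 / sF D c ^ 2) := by ring
        _ ≤ D2 hprof * (((ℓ : ℝ) + 1) ^ 4 / sF D i ^ 2) := mul_le_mul_of_nonneg_left hinv2 hD2
        _ = β := by rw [hβ]; ring
  -- the normalising sums: first and second differences live on `A`
  have hsumA : ∀ g : ↥(cubes D) → ℝ, (∀ c ∉ A, g c = 0) → ∑ c, g c = ∑ c ∈ A, g c := by
    intro g hg
    rw [← Finset.sum_filter_add_sum_filter_not Finset.univ (fun c => c ∈ A),
      Finset.sum_eq_zero (fun c hc => hg c (Finset.mem_filter.1 hc).2), add_zero, Finset.filter_mem_eq_inter, Finset.univ_inter]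
  have hout : ∀ c ∉ A, thetaF D c (toR x.1) = 0 ∧ thetaF D c (toR xp.1) = 0 ∧ thetaF D c (toR xm.1) = 0 := by
    intro c hc
    refine ⟨?_, ?_, ?_⟩
    · by_contra h; exact hc (hmemA c (Or.inl h))
    · by_contra h; exact hc (hmemA c (Or.inr (Or.inl h)))
    · by_contra h; exact hc (hmemA c (Or.inr (Or.inr h)))
  have hNp : |nsqF D xp - nsqF D x| ≤ #A * (2 * α) := by
    unfold nsqF
    rw [← Finset.sum_sub_distrib, hsumA _ (fun c hc => by rw [(hout c hc).1, (hout c hc).2.1]; ring)]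
    calc |∑ c ∈ A, (thetaF D c (toR xp.1) ^ 2 - thetaF D c (toR x.1) ^ 2)| ≤ ∑ c ∈ A, |thetaF D c (toR xp.1) ^ 2 - thetaF D c (toR x.1) ^ 2| :=
          Finset.abs_sum_le_sum_abs _ _
      _ ≤ ∑ _c ∈ A, 2 * α := Finset.sum_le_sum fun c hc =>
          (abs_sq_sub_sq_le (thetaF_nonneg D c _) (thetaF_le_one D c _) (thetaF_nonneg D c _) (thetaF_le_one D c _)).trans
            (mul_le_mul_of_nonneg_left (hmove c hc).1 zero_le_two)
      _ = _ := by rw [Finset.sum_const, nsmul_eq_mul]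
  have hNm : |nsqF D xm - nsqF D x| ≤ #A * (2 * α) := by
    unfold nsqF
    rw [← Finset.sum_sub_distrib, hsumA _ (fun c hc => by rw [(hout c hc).1, (hout c hc).2.2]; ring)]
    calc |∑ c ∈ A, (thetaF D c (toR xm.1) ^ 2 - thetaF D c (toR x.1) ^ 2)| ≤ ∑ c ∈ A, |thetaF D c (toR xm.1) ^ 2 - thetaF D c (toR x.1) ^ 2| :=
          Finset.abs_sum_le_sum_abs _ _
      _ ≤ ∑ _c ∈ A, 2 * α := Finset.sum_le_sum fun c hc =>
          (abs_sq_sub_sq_le (thetaF_nonneg D c _) (thetaF_le_one D c _) (thetaF_nonneg D c _) (thetaF_le_one D c _)).trans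
            (mul_le_mul_of_nonneg_left (hmove c hc).2.1 zero_le_two)
      _ = _ := by rw [Finset.sum_const, nsmul_eq_mul]
  have hNN : |nsqF D xp - 2 * nsqF D x + nsqF D xm| ≤ #A * (2 * β + 2 * α ^ 2) := by
    unfold nsqF
    have e : ∑ c, thetaF D c (toR xp.1) ^ 2 - 2 * ∑ c, thetaF D c (toR x.1) ^ 2 + ∑ c, thetaF D c (toR xm.1) ^ 2 =
        ∑ c, (thetaF D c (toR xp.1) ^ 2 - 2 * thetaF D c (toR x.1) ^ 2 + thetaF D c (toR xm.1) ^ 2) := by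
      rw [Finset.mul_sum, ← Finset.sum_sub_distrib, ← Finset.sum_add_distrib]
    rw [e, hsumA _ (fun c hc => by rw [(hout c hc).1, (hout c hc).2.1, (hout c hc).2.2]; ring)]
    calc |∑ c ∈ A, (thetaF D c (toR xp.1) ^ 2 - 2 * thetaF D c (toR x.1) ^ 2 + thetaF D c (toR xm.1) ^ 2)|
        ≤ ∑ c ∈ A, |thetaF D c (toR xp.1) ^ 2 - 2 * thetaF D c (toR x.1) ^ 2 + thetaF D c (toR xm.1) ^ 2| := Finset.abs_sum_le_sum_abs _ _
      _ ≤ ∑ _c ∈ A, (2 * β + 2 * α ^ 2) := Finset.sum_le_sum fun c hc => by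
          obtain ⟨h1, h2, h3⟩ := hmove c hc
          refine (abs_sq_second_diff_le (thetaF_nonneg D c _) (thetaF_le_one D c _)).trans ?_
          have hsq1 : (thetaF D c (toR xp.1) - thetaF D c (toR x.1)) ^ 2 ≤ α ^ 2 := by
            rw [← sq_abs]; exact pow_le_pow_left₀ (abs_nonneg _) h1 2
          have hsq2 : (thetaF D c (toR xm.1) - thetaF D c (toR x.1)) ^ 2 ≤ α ^ 2 := by
            rw [← sq_abs]; exact pow_le_pow_left₀ (abs_nonneg _) h2 2
          linarith
      _ = _ := by rw [Finset.sum_const, nsmul_eq_mul]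
  -- the quotient rule with the sizes plugged in at `m = 3^{d+2} ≥ #A`
  obtain ⟨hf1, hf2, hf3⟩ : |thetaF D i (toR xp.1) - thetaF D i (toR x.1)| ≤ α ∧ |thetaF D i (toR xm.1) - thetaF D i (toR x.1)| ≤ α ∧
      |thetaF D i (toR xp.1) - 2 * thetaF D i (toR x.1) + thetaF D i (toR xm.1)| ≤ β :=
    hmove i (by rw [hA, Finset.mem_filter]; exact ⟨Finset.mem_univ _, hxi'⟩)
  have hm9 : (0 : ℝ) ≤ 3 ^ (d + 2) := by positivity
  have h4 : |nsqF D xp - nsqF D x| ≤ 2 * 3 ^ (d + 2) * α :=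
    hNp.trans (by nlinarith [mul_le_mul_of_nonneg_right hAcard (mul_nonneg zero_le_two hα0)])
  have h5 : |nsqF D xm - nsqF D x| ≤ 2 * 3 ^ (d + 2) * α :=
    hNm.trans (by nlinarith [mul_le_mul_of_nonneg_right hAcard (mul_nonneg zero_le_two hα0)])
  have h6 : |nsqF D xp - 2 * nsqF D x + nsqF D xm| ≤ 3 ^ (d + 2) * (2 * β + 2 * α ^ 2) :=
    hNN.trans (mul_le_mul_of_nonneg_right hAcard (by positivity))
  have key := quot_second_diff_bound (thetaF_nonneg D i _) (thetaF_le_one D i _) (one_le_nsqF D hMh xm) (one_le_nsqF D hMh x)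
    (one_le_nsqF D hMh xp) hα0 hm9 hf1 hf2 hf3 h4 h5 h6
  have e : hF D i xp - 2 * hF D i x + hF D i xm =
      thetaF D i (toR xp.1) / Real.sqrt (nsqF D xp) - 2 * (thetaF D i (toR x.1) / Real.sqrt (nsqF D x)) +
        thetaF D i (toR xm.1) / Real.sqrt (nsqF D xm) := rfl
  rw [e]
  refine key.trans (le_of_eq ?_)
  rw [hα, hβ]; unfold C2F
  field_simp

end Literature.MathematicalPhysics.QuantumFieldTheory.Balaban1983to89.B6Partition118KLevelFineSecond

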